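import Summits.CriticalPhenomena.CardyFormulaZ2.Theorems.CardyBoundaryCoulombGasBoundaryDefectGaussianRS17HeightsExistPart2

/-!
# Stub `s17_heightsExist` of line `rainbow-monomials-in-excursion-kernels` — Part 4:
# the weight `w = sgn s - sgn (bit h₀)` vanishes at every prescribed corner
# (crux `BoundaryDefectGaussianR`, stmt-CriticalPhenomena-14132; insertion dictionary D2, T5c)

Setting of Part 2 (`M = ι.model V` admissible, FLAT at radius `sinkLegs + 4`, radius-`3` CHARTS; a
valid `h₀`, a rainbow `ω ⊆ E`, an arrow assignment `s` invariant off the cuts and forced at the cuts;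
`w c = sgn (s c) - sgn (bit h₀ c)`). A PRESCRIBED CORNER is a corner `(x, f)` whose vertex `x` is a
prescribed vertex-cell (arc vertex or ghost) and whose face `f` is a prescribed face-cell (a collar
face: neither interior nor a pocket). THEOREM (`he_pp_good`, registered one-line form
`s17_heightsExist_part4`): `w = 0` at every prescribed corner, i.e. `s` agrees with `bit h₀` there.

Proof. As in Lemma V (Part 46, `pcc_of_charts`): the window of the corner (`window_of_prescribed`)
contains a free state (the collar face) and a wired one (the prescribed vertex), hence an ACTIVE dart,
around which flatness makes the boundary a straight strip (`strip_of_active`, Part 44) with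
`f = gapFace (z, k)` met on a free stretch. On the strip (`he_strip_good`, the analogue of
`strip_pair`): if `x` is `z` or its ghost `z + dir k`, dart `(z, k)` CLOSES the arc and creates the
registered end `(z + dir k, k + 1)`; if `x` is `z' = z + dir (k+1)` or its ghost, the next dart OPENS
the arc and creates the registered end `(z' + dir k, k + 2)`. At registered ends `w = 0`
(`he_end_good`, Part 2), and the corners of `f` at the arc vertices `z`, `z'` are joined to these ends
by the frozen turns along the spokes, which preserve `w` (`he_transfer`).
-/

namespace Summit.CriticalPhenomena.CardyFormulaZ2.Cruxes.BoundaryDefectGaussianR.RainbowMonomialsInExcursionKernels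

open Finset Literature.Probability.LatticeModels Literature.Probability.LatticeModels.CollarLegModel
open Literature.Probability.Percolation

/-! ### Corners, faces and spokes -/

/-- The four faces at a vertex are distinct: the face determines the corner. [folklore] -/
theorem he_cFace_inj {v : ℤ × ℤ} {j k : Fin 4} (h : ofSite (cFace (toSite v, j)) = ofSite (cFace (toSite v, k))) : j = k := by
  rw [ofSite_cFace_toSite, ofSite_cFace_toSite] at h
  fin_cases j <;> fin_cases k <;> simp [Prod.ext_iff] at h ⊢ <;> omega

/-- **A spoke is frozen open**: the edge joining an arc vertex `a` to its outside neighbour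
`a + dir j` (a ghost) is a frozen open edge. [folklore] -/
theorem he_spoke_open (M : CollarLegModel) {a : ℤ × ℤ} (ha : a ∈ M.arcVerts) {j : Fin 4} (hj : a + dir j ∉ M.V)
    {e : (ℤ × ℤ) × Bool}
    (hend : (e.1 = a ∧ SixVertex.edgeTip e = a + dir j) ∨ (e.1 = a + dir j ∧ SixVertex.edgeTip e = a)) :
    e ∈ M.openEdges := by
  have haV : a ∈ M.V := (mem_inter.1 ha).2
  have hg : a + dir j ∈ M.ghosts :=
    mem_sdiff.2 ⟨mem_union_left _ (mem_biUnion.2 ⟨a, ha, mem_neighbours_iff.2 ⟨j, rfl⟩⟩), hj⟩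
  rw [openEdges, mem_filter, frozenEdges, mem_sdiff]
  refine ⟨⟨?_, ?_⟩, ?_⟩
  · rw [SixVertex.mem_edges_iff]
    rcases hend with ⟨h1, -⟩ | ⟨h1, -⟩
    · exact Or.inl (h1 ▸ mem_union_left _ haV)
    · exact Or.inl (h1 ▸ mem_union_right _ hg)
  · rw [mem_E_iff]
    rcases hend with ⟨-, h2⟩ | ⟨h1, -⟩
    · exact fun h => hj (h2 ▸ h.2.2)
    · exact fun h => hj (h1 ▸ h.2.1)
  · rcases hend with ⟨h1, h2⟩ | ⟨h1, h2⟩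
    · exact Or.inl ⟨h1 ▸ ha, h2 ▸ hg⟩
    · exact Or.inr (Or.inl ⟨h2 ▸ ha, h1 ▸ hg⟩)

/-- **The turn along a spoke, from the ghost**: the corner `(g, j + 1)` at the ghost `g = a + dir j`
turns (in the completed configuration of `∅`) to the corner `(a, j)` at the arc vertex. [folklore] -/
theorem he_spoke_next_out (M : CollarLegModel) {a : ℤ × ℤ} (ha : a ∈ M.arcVerts) {j : Fin 4} (hj : a + dir j ∉ M.V) :
    cTgt (toSite (a + dir j), j + 1) ∈ M.cfgOf ∅ ∧
      nextCorner (M.cfgOf ∅) (toSite (a + dir j), j + 1) = (toSite a, j) := by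
  obtain ⟨e, hce, hend⟩ := se_corner_edge (a + dir j) (j + 1)
  have hga : a + dir j + dir (j + 1 + 1) = a := by
    rw [add_assoc, show j + 1 + 1 = j + 2 from fin4_add_one_add_one j, tp_dir_add_two]; abel
  rw [hga] at hend
  have hm : cTgt (toSite (a + dir j), j + 1) ∈ M.cfgOf ∅ :=
    (se_cTgt_mem_cfgOf_iff M ∅ hce).2 (Or.inr (he_spoke_open M ha hj (hend.elim Or.inr Or.inl)))
  refine ⟨hm, ?_⟩
  rw [nextCorner_of_mem hm]
  simp only
  rw [← se_toSite_add_dir, hga, fin4_add_one_add_three]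

/-- **The turn along a spoke, from the arc vertex**: the corner `(a, j + 3)` at the arc vertex turns
to the corner `(g, j + 2)` at the ghost `g = a + dir j`. [folklore] -/
theorem he_spoke_next_in (M : CollarLegModel) {a : ℤ × ℤ} (ha : a ∈ M.arcVerts) {j : Fin 4} (hj : a + dir j ∉ M.V) :
    cTgt (toSite a, j + 3) ∈ M.cfgOf ∅ ∧
      nextCorner (M.cfgOf ∅) (toSite a, j + 3) = (toSite (a + dir j), j + 2) := by
  have h31 : ∀ i : Fin 4, i + 3 + 1 = i := by decide
  have h33 : ∀ i : Fin 4, i + 3 + 3 = i + 2 := by decide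
  obtain ⟨e, hce, hend⟩ := se_corner_edge a (j + 3)
  rw [h31] at hend
  have hm : cTgt (toSite a, j + 3) ∈ M.cfgOf ∅ :=
    (se_cTgt_mem_cfgOf_iff M ∅ hce).2 (Or.inr (he_spoke_open M ha hj hend))
  refine ⟨hm, ?_⟩
  rw [nextCorner_of_mem hm]
  simp only
  rw [h31, ← se_toSite_add_dir, h33]

/-! ### On a straight strip: the prescribed corners of a collar face are good -/

section Strip

variable (ι : LegInsertionData) (V : Finset (ℤ × ℤ)) {d₀ : Dart} (hadm : ι.IsAdmissible V)
  (h0 : outDart V ι.sink = some d₀) {st : ℕ → WalkState}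
  (hst : ∀ t, st t = List.foldl (fun s d => s.step (ι.startAt V d)) ι.init ((cycle V d₀).take t))
  (hflat : ∀ x ∈ insert ι.sink ι.source, ∃ dvec : ℤ × ℤ,
    (dvec = (1, 0) ∨ dvec = (-1, 0) ∨ dvec = (0, 1) ∨ dvec = (0, -1)) ∧
    ∀ v : ℤ × ℤ, (v.1 - x.1) ^ 2 + (v.2 - x.2) ^ 2 ≤ ((ι.sinkLegs : ℤ) + 4) ^ 2 →
      (v ∈ V ↔ 0 ≤ (v.1 - x.1) * dvec.1 + (v.2 - x.2) * dvec.2))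
  (hchart : ∀ u ∈ V, ∀ k : Fin 4, u + dir k ∉ V → ∃ (K : Fin 4) (c₁ c₂ : ℤ),
    (∀ v : ℤ × ℤ, |v.1 - u.1| ≤ 3 → |v.2 - u.2| ≤ 3 →
      (v ∈ V ↔ c₂ ≤ v.1 * (dir (K + 1)).1 + v.2 * (dir (K + 1)).2)) ∨
    (∀ v : ℤ × ℤ, |v.1 - u.1| ≤ 3 → |v.2 - u.2| ≤ 3 →
      (v ∈ V ↔ c₁ ≤ v.1 * (dir K).1 + v.2 * (dir K).2 ∧
        c₂ ≤ v.1 * (dir (K + 1)).1 + v.2 * (dir (K + 1)).2)) ∨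
    (∀ v : ℤ × ℤ, |v.1 - u.1| ≤ 3 → |v.2 - u.2| ≤ 3 →
      (v ∈ V ↔ c₂ ≤ v.1 * (dir (K + 1)).1 + v.2 * (dir (K + 1)).2 ∨
        v.1 * (dir K).1 + v.2 * (dir K).2 ≤ c₁)))
  {h₀ : ↥(ι.model V).freeCells → ℤ} (hh₀ : h₀ ∈ (ι.model V).configs)
  {ω : Finset ((ℤ × ℤ) × Bool)} (hω : ω ⊆ (ι.model V).E) (hR : ι.Rainbow V ω)
  {s : Site 2 × Fin 4 → Bool}
  (hs1 : ∀ c ∈ cornerSet (ι.model V).piece, ¬(ι.model V).IsCut c → s (nextCorner ((ι.model V).cfgOf ω) c) = s c)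
  (hs2 : ∀ c ∈ cornerSet (ι.model V).piece, (ι.model V).IsCut c → s c = (ι.model V).bit h₀ c)

include h0 hst in
/-- **A junction closing the arc creates the registered end `(ghost, k + 1)`.** [folklore] -/
theorem he_end_close {t : ℕ} (ht : t < (cycle V d₀).length) (hB : (st t).wired = true) (hA : (st (t + 1)).wired = false) :
    ∃ m : ℤ, ((toSite (dartTip (cycle V d₀)[t]), ((cycle V d₀)[t]).2 + 1), m) ∈ ι.strandEnds V := by
  rcases st_step_cases ι V hst ht with ⟨-, hw⟩ | ⟨hsgn, ⟨hl, -⟩ | ⟨-, hw0, -⟩⟩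
  · rw [hB, hA] at hw; exact absurd hw (by decide)
  · have hne : (st (t + 1)).level ≠ (st t).level := by rcases hsgn with h | h <;> rw [hl, h] <;> omega
    have hnj : ¬ ((st (t + 1)).level = (st t).level + 2 ∨ (st t).level = (st (t + 1)).level + 2) := by
      rcases hsgn with h | h <;> rw [hl, h] <;> omega
    refine ⟨min (st t).level (st (t + 1)).level, (se_mem_strandEnds_iff ι V h0 hst).2 ⟨t, ht, ?_⟩⟩
    rw [se_endsAt_junction _ _ _ hne hnj, if_pos hB]
    exact List.mem_singleton_self _
  · rw [hB] at hw0; exact absurd hw0 (by decide)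

include h0 hst in
/-- **A junction opening the arc creates the registered end `(ghost, k + 2)`.** [folklore] -/
theorem he_end_open {t : ℕ} (ht : t < (cycle V d₀).length) (hB : (st t).wired = false) (hA : (st (t + 1)).wired = true) :
    ∃ m : ℤ, ((toSite (dartTip (cycle V d₀)[t]), ((cycle V d₀)[t]).2 + 2), m) ∈ ι.strandEnds V := by
  rcases st_step_cases ι V hst ht with ⟨-, hw⟩ | ⟨hsgn, ⟨hl, -⟩ | ⟨-, -, hw1⟩⟩
  · rw [hB, hA] at hw; exact absurd hw (by decide)
  · have hne : (st (t + 1)).level ≠ (st t).level := by rcases hsgn with h | h <;> rw [hl, h] <;> omega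
    have hnj : ¬ ((st (t + 1)).level = (st t).level + 2 ∨ (st t).level = (st (t + 1)).level + 2) := by
      rcases hsgn with h | h <;> rw [hl, h] <;> omega
    refine ⟨min (st t).level (st (t + 1)).level, (se_mem_strandEnds_iff ι V h0 hst).2 ⟨t, ht, ?_⟩⟩
    rw [se_endsAt_junction _ _ _ hne hnj, if_neg (by rw [hB]; decide)]
    exact List.mem_singleton_self _
  · rw [hA] at hw1; exact absurd hw1 (by decide)

variable {c cp : ℕ} {z : ℤ × ℤ} {k : Fin 4}
  (hc : c < (cycle V d₀).length) (hzc : (cycle V d₀)[c] = (z, k))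
  (hcp : cp < (cycle V d₀).length) (hcp1 : (cp + 1) % (cycle V d₀).length = c)
  (hzp : (cycle V d₀)[cp] = (z - dir (k + 1), k))
  (m0 : z ∈ V) (mW : z - dir (k + 1) ∈ V) (mE : z + dir (k + 1) ∈ V) (mS : z - dir k ∈ V)
  (nN : z + dir k ∉ V) (nNW : z - dir (k + 1) + dir k ∉ V) (nNE : z + dir (k + 1) + dir k ∉ V)
  (nNN : z + dir k + dir k ∉ V) (nNNW : z - dir (k + 1) + dir k + dir k ∉ V)
  (nNNE : z + dir (k + 1) + dir k + dir k ∉ V)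

include hadm h0 hst hflat hchart hh₀ hω hR hs1 hs2 hc hzc hcp hcp1 hzp m0 mW mE mS nN nNW nNE nNN nNNW nNNE in
/-- **On a straight strip the prescribed corners of a collar face are good.** Let dart `c = (z, k)`
lie on a straight strip with the stretch after it FREE, so that `f = gapFace (z, k)` is a collar face,
and let `x` be a prescribed vertex-cell at `f`. If `x` is `z` or the ghost `z + dir k`, dart `c`
closes the arc (a wired stretch touches it) and creates the registered end `(z + dir k, k + 1)`,
joined to `(z, k)` along the open spoke; if `x` is `z' = z + dir (k+1)` or the ghost `z' + dir k`,
the next dart opens the arc and creates the registered end `(z' + dir k, k + 2)`, to which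
`(z', k + 3)` turns along the open spoke. Registered ends carry `w = 0` (`he_end_good`) and the
spoke turns preserve `w` (`he_transfer`); so `w = 0` at the corner of `f` at `x`. [folklore] -/
theorem he_strip_good (hfree : (st (c + 1)).wired = false)
    (hcs : (cycle V d₀)[(c + 1) % (cycle V d₀).length]'(Nat.mod_lt _ (by omega)) = (z + dir (k + 1), k))
    (mEE : z + dir (k + 1) + dir (k + 1) ∈ V) (mSE : z + dir (k + 1) - dir k ∈ V)
    (nNEE : z + dir (k + 1) + dir (k + 1) + dir k ∉ V) (nNNEE : z + dir (k + 1) + dir (k + 1) + dir k + dir k ∉ V)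
    {x : ℤ × ℤ} (hx : x ∈ (ι.model V).vertexCells) (hxf : (x, false) ∉ (ι.model V).freeCells)
    (hfx : gapFace (z, k) ∈ SixVertex.vertexFaces x) (j : Fin 4)
    (hj : ofSite (cFace (toSite x, j)) = gapFace (z, k)) :
    BKW.sgn (s (toSite x, j)) - BKW.sgn ((ι.model V).bit h₀ (toSite x, j)) = 0 := by
  have hP : 0 < (cycle V d₀).length := by omega
  have hc' : (c + 1) % (cycle V d₀).length < (cycle V d₀).length := Nat.mod_lt _ hP
  have hmod := st_mod_succ ι V hadm h0 hst hc
  have h31 : ∀ i : Fin 4, i + 3 + 1 = i := by decide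
  obtain ⟨E0, E1, -, -⟩ := se_gapFace_eq_cFace z k
  obtain ⟨-, -, E2, E3⟩ := se_gapFace_eq_cFace (z + dir (k + 1)) k
  rw [add_sub_cancel_right] at E2 E3
  rcases corner_cases hfx with hxz | hxz | hxz | hxz <;> rw [hxz] at hx hxf hj ⊢ <;>
    have hpres := mem_arc_or_ghosts_of_not_mem_freeCells (ι.model V) hx hxf
  · -- the arc vertex `z`: the end of the closing junction at dart `c`, joined along the spoke
    rcases hpres with ⟨-, harc⟩ | ⟨hnV, -⟩
    · have hw := strip_arc_vertex ι V hadm h0 hst hc hzc mW mE mS harc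
      rw [hfree] at hw
      have hB : (st c).wired = true := by simpa using hw
      obtain ⟨m, hm⟩ := he_end_close ι V h0 hst hc hB hfree
      rw [hzc, dartTip_mk] at hm
      have hw0 := he_end_good ι V hadm hflat hchart hh₀ hω hR hs1 hs2 hm
      rw [he_cFace_inj (hj.trans E0)]
      have za : z ∈ (ι.model V).arcVerts := mem_inter.2 ⟨harc, m0⟩
      obtain ⟨-, hnext⟩ := he_spoke_next_out (ι.model V) za nN
      have hcg : (toSite (z + dir k), k + 1) ∈ cornerSet (ι.model V).piece := by
        rw [mem_cornerSet, dict_mem_piece_iff, ofSite_toSite]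
        exact mem_union_right _ (mem_sdiff.2 ⟨mem_union_left _ (mem_biUnion.2 ⟨z, za, mem_neighbours_iff.2 ⟨k, rfl⟩⟩), nN⟩)
      have hl : ¬(ι.model V).TargetsLive (toSite (z + dir k), k + 1) := fun h => nN ((se_targetsLive_iff _ _ _).1 h).1
      have htr := he_transfer ι V hadm hflat hchart hh₀ hω hR hs1 hs2 hcg hl
      rw [hnext] at htr
      simp only at hw0
      rw [htr, hw0]
    · exact absurd m0 hnV
  · -- the ghost `z + dir k`: the end of the closing junction at dart `c`
    rcases hpres with ⟨hV, -⟩ | ⟨-, hg⟩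
    · exact absurd hV nN
    · have hw := strip_ghost ι V hadm h0 hst hc hzc hcp hcp1 hzp m0 mW mE mS nN nNW nNE nNN nNNW nNNE hg
      rw [hfree] at hw
      have hB : (st c).wired = true := by simpa using hw
      obtain ⟨m, hm⟩ := he_end_close ι V h0 hst hc hB hfree
      rw [hzc, dartTip_mk] at hm
      have hw0 := he_end_good ι V hadm hflat hchart hh₀ hω hR hs1 hs2 hm
      rw [he_cFace_inj (hj.trans E1)]
      simpa using hw0
  · -- the arc vertex `z' = z + dir (k+1)`: joined along the spoke to the end of the opening junction at the next dart
    have hB' : (st ((c + 1) % (cycle V d₀).length)).wired = false := by rw [hmod.2, hfree]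
    rcases hpres with ⟨-, harc⟩ | ⟨hnV, -⟩
    · have hw := strip_arc_vertex ι V hadm h0 hst hc' hcs (mem_of_eq m0 (by abel)) mEE mSE harc
      rw [hB'] at hw
      have hA : (st ((c + 1) % (cycle V d₀).length + 1)).wired = true := by simpa using hw
      obtain ⟨m, hm⟩ := he_end_open ι V h0 hst hc' hB' hA
      rw [hcs, dartTip_mk] at hm
      have hw0 := he_end_good ι V hadm hflat hchart hh₀ hω hR hs1 hs2 hm
      rw [he_cFace_inj (hj.trans E2)]
      have za : z + dir (k + 1) ∈ (ι.model V).arcVerts := mem_inter.2 ⟨harc, mE⟩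
      obtain ⟨-, hnext⟩ := he_spoke_next_in (ι.model V) za nNE
      have hca : (toSite (z + dir (k + 1)), k + 3) ∈ cornerSet (ι.model V).piece := by
        rw [mem_cornerSet, dict_mem_piece_iff, ofSite_toSite]; exact mem_union_left _ mE
      have hl : ¬(ι.model V).TargetsLive (toSite (z + dir (k + 1)), k + 3) := fun h =>
        nNE (by have := ((se_targetsLive_iff _ _ _).1 h).2; rwa [h31] at this)
      have htr := he_transfer ι V hadm hflat hchart hh₀ hω hR hs1 hs2 hca hl
      rw [hnext] at htr
      simp only at hw0
      rw [← htr, hw0]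
    · exact absurd mE hnV
  · -- the ghost `z' + dir k`: the end of the opening junction at the next dart
    have hB' : (st ((c + 1) % (cycle V d₀).length)).wired = false := by rw [hmod.2, hfree]
    have hzp' : (cycle V d₀)[c] = (z + dir (k + 1) - dir (k + 1), k) := by rw [add_sub_cancel_right]; exact hzc
    rcases hpres with ⟨hV, -⟩ | ⟨-, hg⟩
    · exact absurd hV nNE
    · have hw := strip_ghost ι V hadm h0 hst hc' hcs hc rfl hzp' mE (mem_of_eq m0 (by abel)) mEE mSE nNE
        (nmem_of_eq nN (by abel)) nNEE nNNE (nmem_of_eq nNN (by abel)) nNNEE hg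
      rw [hB'] at hw
      have hA : (st ((c + 1) % (cycle V d₀).length + 1)).wired = true := by simpa using hw
      obtain ⟨m, hm⟩ := he_end_open ι V h0 hst hc' hB' hA
      rw [hcs, dartTip_mk] at hm
      have hw0 := he_end_good ι V hadm hflat hchart hh₀ hω hR hs1 hs2 hm
      rw [he_cFace_inj (hj.trans E3)]
      simpa using hw0

end Strip

/-! ### Every prescribed corner is good -/

section Assembly

variable (ι : LegInsertionData) (V : Finset (ℤ × ℤ)) (hadm : ι.IsAdmissible V)
  (hflat : ∀ x ∈ insert ι.sink ι.source, ∃ dvec : ℤ × ℤ,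
    (dvec = (1, 0) ∨ dvec = (-1, 0) ∨ dvec = (0, 1) ∨ dvec = (0, -1)) ∧
    ∀ v : ℤ × ℤ, (v.1 - x.1) ^ 2 + (v.2 - x.2) ^ 2 ≤ ((ι.sinkLegs : ℤ) + 4) ^ 2 →
      (v ∈ V ↔ 0 ≤ (v.1 - x.1) * dvec.1 + (v.2 - x.2) * dvec.2))
  (hchart : ∀ u ∈ V, ∀ k : Fin 4, u + dir k ∉ V → ∃ (K : Fin 4) (c₁ c₂ : ℤ),
    (∀ v : ℤ × ℤ, |v.1 - u.1| ≤ 3 → |v.2 - u.2| ≤ 3 →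
      (v ∈ V ↔ c₂ ≤ v.1 * (dir (K + 1)).1 + v.2 * (dir (K + 1)).2)) ∨
    (∀ v : ℤ × ℤ, |v.1 - u.1| ≤ 3 → |v.2 - u.2| ≤ 3 →
      (v ∈ V ↔ c₁ ≤ v.1 * (dir K).1 + v.2 * (dir K).2 ∧
        c₂ ≤ v.1 * (dir (K + 1)).1 + v.2 * (dir (K + 1)).2)) ∨
    (∀ v : ℤ × ℤ, |v.1 - u.1| ≤ 3 → |v.2 - u.2| ≤ 3 →
      (v ∈ V ↔ c₂ ≤ v.1 * (dir (K + 1)).1 + v.2 * (dir (K + 1)).2 ∨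
        v.1 * (dir K).1 + v.2 * (dir K).2 ≤ c₁)))
  {h₀ : ↥(ι.model V).freeCells → ℤ} (hh₀ : h₀ ∈ (ι.model V).configs)
  {ω : Finset ((ℤ × ℤ) × Bool)} (hω : ω ⊆ (ι.model V).E) (hR : ι.Rainbow V ω)
  {s : Site 2 × Fin 4 → Bool}
  (hs1 : ∀ c ∈ cornerSet (ι.model V).piece, ¬(ι.model V).IsCut c → s (nextCorner ((ι.model V).cfgOf ω) c) = s c)
  (hs2 : ∀ c ∈ cornerSet (ι.model V).piece, (ι.model V).IsCut c → s c = (ι.model V).bit h₀ c)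

include hadm hflat hchart hh₀ hω hR hs1 hs2 in
/-- **`w = 0` at every prescribed corner.** For a prescribed vertex-cell `x` (arc vertex or ghost)
and a prescribed face-cell `f` at it (a collar face), `s` and `bit h₀` agree at the corner of `f` at
`x`: the window of the corner contains a junction, flatness straightens the boundary around it
(`strip_of_active`), and `he_strip_good` applies. [cite: BaxterKellandWu1976, §3–§4] -/
theorem he_pp_good {x f : ℤ × ℤ} (hx : x ∈ (ι.model V).vertexCells) (hxf : (x, false) ∉ (ι.model V).freeCells)
    (hf : f ∈ SixVertex.vertexFaces x) (hfc : f ∈ (ι.model V).faceCells) (hff : (f, true) ∉ (ι.model V).freeCells)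
    (j : Fin 4) (hj : ofSite (cFace (toSite x, j)) = f) :
    BKW.sgn (s (toSite x, j)) - BKW.sgn ((ι.model V).bit h₀ (toSite x, j)) = 0 := by
  obtain ⟨d₀, h0, -, hv₀, ht₀, -⟩ := s3_of_admissible ι V hadm
  set st : ℕ → WalkState := fun t => List.foldl (fun s d => s.step (ι.startAt V d)) ι.init ((cycle V d₀).take t)
    with hst_def
  have hst : ∀ t, st t = List.foldl (fun s d => s.step (ι.startAt V d)) ι.init ((cycle V d₀).take t) := fun _ => rfl
  have hCH := chart8_of_chart3 hchart
  set P := (cycle V d₀).length with hPdef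
  have hP : 0 < P := length_cycle_pos ι V hadm h0
  obtain ⟨hni, hnp⟩ := not_mem_of_not_mem_freeCells (ι.model V) hff
  obtain ⟨c₀, hc₀, hface, hwired⟩ := window_of_prescribed ι V hadm h0 hst hCH hx hxf hf hfc hff
  -- a collar face is met on a free stretch
  have hfree : ∀ c, ∀ hc : c < P, f = gapFace (cycle V d₀)[c] → (st (c + 1)).wired = false := by
    intro c hc hfc'
    by_contra hw
    have hw' : (st (c + 1)).wired = true := by simpa using hw
    have hpk : f ∈ (ι.collar V).pocket := (mem_collar_pocket_iff ι V h0 hst).2 ⟨c, hc, hw', hfc'.symm⟩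
    have hex := cycle_getElem_exterior ι V hadm h0 hc
    have hbd : f ∈ SixVertex.bdryFaces V := by
      rw [hfc']; have := (gapFace_mem_bdryFaces hex.1 hex.2).1; rwa [Prod.mk.eta] at this
    exact hnp (Finset.mem_inter.mpr ⟨hpk, hbd⟩)
  -- positions in the window, as offsets from `c₀`
  have i0 : c₀ = (c₀ + 0) % P := by rw [add_zero, Nat.mod_eq_of_lt hc₀]
  have i2 : ((c₀ + 1) % P + 1) % P = (c₀ + 2) % P := mod_succ_succ
  have i3 : (((c₀ + 1) % P + 1) % P + 1) % P = (c₀ + 3) % P := by rw [i2, Nat.mod_add_mod]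
  have hfpos : ∃ fpos, fpos ≤ 2 ∧ f = gapFace ((cycle V d₀)[(c₀ + fpos) % P]'(Nat.mod_lt _ hP)) := by
    rcases hface with h | h | h
    · exact ⟨0, by norm_num, by rw [h, getElem_cycle_congr hc₀ (Nat.mod_lt _ hP) i0]⟩
    · exact ⟨1, by norm_num, h⟩
    · exact ⟨2, by norm_num, by rw [h, getElem_cycle_congr (Nat.mod_lt _ hP) (Nat.mod_lt _ hP) i2]⟩
  obtain ⟨fpos, hfpos2, hfeq⟩ := hfpos
  have hAB : ∀ a : ℕ, (st ((c₀ + a) % P + 1)).wired = (st ((c₀ + (a + 1)) % P)).wired := fun a => by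
    rw [← (st_mod_succ ι V hadm h0 hst (Nat.mod_lt _ hP)).2, Nat.mod_add_mod, add_assoc]
  have hsome_true : (st ((c₀ + 0) % P)).wired = true ∨ (st ((c₀ + 1) % P)).wired = true ∨
      (st ((c₀ + 2) % P)).wired = true ∨ (st ((c₀ + 3) % P)).wired = true ∨ (st ((c₀ + 3) % P + 1)).wired = true := by
    rw [← i0, ← i2, ← i3]; exact hwired
  have hsome_false : (st ((c₀ + 1) % P)).wired = false ∨ (st ((c₀ + 2) % P)).wired = false ∨
      (st ((c₀ + 3) % P)).wired = false := by
    have h := hfree _ (Nat.mod_lt _ hP) hfeq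
    rw [hAB] at h
    interval_cases fpos
    · exact Or.inl h
    · exact Or.inr (Or.inl h)
    · exact Or.inr (Or.inr h)
  have hjunc : ∃ m, m ≤ 3 ∧ (st ((c₀ + m) % P)).wired ≠ (st ((c₀ + m) % P + 1)).wired := by
    rcases bool_window_flip _ _ _ _ _ hsome_true hsome_false with h | h | h | h
    · exact ⟨0, by norm_num, by rwa [hAB]⟩
    · exact ⟨1, by norm_num, by rwa [hAB]⟩
    · exact ⟨2, by norm_num, by rwa [hAB]⟩
    · exact ⟨3, by norm_num, h⟩
  obtain ⟨m, hm3, hne⟩ := hjunc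
  -- the straight strip through the window
  have hne' : ¬ ((st ((c₀ + m) % P + 1)).level = (st ((c₀ + m) % P)).level ∧
      (st ((c₀ + m) % P + 1)).wired = (st ((c₀ + m) % P)).wired) := fun h => hne h.2.symm
  obtain ⟨z, k, hz, hzp, hzs, m0, mW, mE, mS, nN, nNW, nNE, nNN, nNNW, nNNE, mEE, mSE, nNEE, nNNEE⟩ :=
    strip_of_active ι V hadm h0 hst hflat (t := (c₀ + m) % P) (Nat.mod_lt _ hP) hne' (e := 4 + fpos - m) (by omega) (by omega)
  have hidx : ((c₀ + m) % P + 4 * P - 4 + (4 + fpos - m)) % P = (c₀ + fpos) % P := window_offset hP hm3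
  have hfz : f = gapFace (z, k) := by
    rw [hfeq, ← getElem_cycle_congr (Nat.mod_lt _ hP) (Nat.mod_lt _ hP) hidx, hz]
  have hfree' : (st (((c₀ + m) % P + 4 * P - 4 + (4 + fpos - m)) % P + 1)).wired = false :=
    hfree _ (Nat.mod_lt _ hP) (by rw [hz, hfz])
  have hcp1 : (((c₀ + m) % P + 4 * P - 4 + (4 + fpos - m - 1)) % P + 1) % P =
      ((c₀ + m) % P + 4 * P - 4 + (4 + fpos - m)) % P := by
    rw [idx_succ, show 4 + fpos - m - 1 + 1 = 4 + fpos - m by omega]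
  rw [hfz] at hf hj
  exact he_strip_good ι V hadm h0 hst hflat hchart hh₀ hω hR hs1 hs2 (Nat.mod_lt _ hP) hz (Nat.mod_lt _ hP) hcp1 hzp
    m0 mW mE mS nN nNW nNE nNN nNNW nNNE hfree' hzs mEE mSE nNEE nNNEE hx hxf hf j hj

end Assembly

/-- **Sub-goal `s17_heightsExist_part4`** (registered on stmt-CriticalPhenomena-14132; T5c, Part 4):
for an ADMISSIBLE insertion with FLAT points (radius `sinkLegs + 4`) and radius-`3` CHARTS, a valid
`h₀`, a RAINBOW `ω ⊆ E` and an arrow assignment `s` invariant under the turning rule of `cfgOf ω` off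
the cuts over the piece and equal to `bit h₀` at the cuts: `s` agrees with `bit h₀` at every
PRESCRIBED corner (prescribed vertex-cell against prescribed face-cell). [cite: BaxterKellandWu1976, §3–§4] -/
theorem s17_heightsExist_part4 : ∀ (ι : Literature.Probability.LatticeModels.CollarLegModel.LegInsertionData) (V : Finset (ℤ × ℤ)), ι.IsAdmissible V → (∀ x ∈ insert ι.sink ι.source, ∃ dvec : ℤ × ℤ, (dvec = (1, 0) ∨ dvec = (-1, 0) ∨ dvec = (0, 1) ∨ dvec = (0, -1)) ∧ ∀ v : ℤ × ℤ, (v.1 - x.1) ^ 2 + (v.2 - x.2) ^ 2 ≤ ((ι.sinkLegs : ℤ) + 4) ^ 2 → (v ∈ V ↔ 0 ≤ (v.1 - x.1) * dvec.1 + (v.2 - x.2) * dvec.2)) → (∀ u ∈ V, ∀ k : Fin 4, u + Literature.Probability.LatticeModels.CollarLegModel.dir k ∉ V → ∃ (K : Fin 4) (c₁ c₂ : ℤ), (∀ v : ℤ × ℤ, |v.1 - u.1| ≤ 3 → |v.2 - u.2| ≤ 3 → (v ∈ V ↔ c₂ ≤ v.1 * (Literature.Probability.LatticeModels.CollarLegModel.dir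 (K + 1)).1 + v.2 * (Literature.Probability.LatticeModels.CollarLegModel.dir (K + 1)).2)) ∨ (∀ v : ℤ × ℤ, |v.1 - u.1| ≤ 3 → |v.2 - u.2| ≤ 3 → (v ∈ V ↔ c₁ ≤ v.1 * (Literature.Probability.LatticeModels.CollarLegModel.dir K).1 + v.2 * (Literature.Probability.LatticeModels.CollarLegModel.dir K).2 ∧ c₂ ≤ v.1 * (Literature.Probability.LatticeModels.CollarLegModel.dir (K + 1)).1 + v.2 * (Literature.Probability.LatticeModels.CollarLegModel.dir (K + 1)).2)) ∨ (∀ v : ℤ × ℤ, |v.1 - u.1| ≤ 3 → |v.2 - u.2| ≤ 3 → (v ∈ V ↔ c₂ ≤ v.1 * (Literature.Probability.LatticeModels.CollarLegModel.dir (K + 1)).1 + v.2 * (Literature.Probability.LatticeModels.CollarLegModel.dir (K + 1)).2 ∨ v.1 * (Literature.Probability.LatticeModels.CollarLegModel.dir K).1 + v.2 * (Literature.Probability.LatticeModels.CollarLegModel.dir K).2 ≤ c₁))) → ∀ (h₀ : ↥(ι.model V).freeCells → ℤ), h₀ ∈ (ι.model V).configs → ∀ (ω : Finset ((ℤ ×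 ℤ) × Bool)), ω ⊆ (ι.model V).E → ι.Rainbow V ω → ∀ (s : Literature.Probability.LatticeModels.Site 2 × Fin 4 → Bool), (∀ c ∈ Literature.Probability.Percolation.cornerSet (ι.model V).piece, ¬(ι.model V).IsCut c → s (Literature.Probability.LatticeModels.nextCorner ((ι.model V).cfgOf ω) c) = s c) → (∀ c ∈ Literature.Probability.Percolation.cornerSet (ι.model V).piece, (ι.model V).IsCut c → s c = (ι.model V).bit h₀ c) → ∀ x ∈ (ι.model V).vertexCells, (x, false) ∉ (ι.model V).freeCells → ∀ f ∈ Literature.Probability.LatticeModels.SixVertex.vertexFaces x, f ∈ (ι.model V).faceCells → (f, true) ∉ (ι.model V).freeCells → ∀ j : Fin 4, Literature.Probability.LatticeModels.CollarLegModel.ofSite (Literature.Probability.LatticeModels.cFace (Literature.Probability.LatticeModels.CollarLegModel.toSite x, j)) = f → s (Literature.Probability.LatticeModels.CollarLegModel.toSite x, j) = (ι.model V).bit h₀ (Literature.Probability.LatticeModels.CollarLegModel.toSite x, j) := by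
  intro ι V hadm hflat hchart h₀ hh₀ ω hω hR s hs1 hs2 x hx hxf f hf hfc hff j hj
  have h := he_pp_good ι V hadm hflat hchart hh₀ hω hR hs1 hs2 hx hxf hf hfc hff j hj
  revert h
  cases s (toSite x, j) <;> cases (ι.model V).bit h₀ (toSite x, j) <;> simp [BKW.sgn]

end Summit.CriticalPhenomena.CardyFormulaZ2.Cruxes.BoundaryDefectGaussianR.RainbowMonomialsInExcursionKernels
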